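import Literature.Computability.AlgebraicComplexity.HWY10SumOfSquares
import Literature.Computability.AlgebraicComplexity.PBoundedGrowth
import Summits.ValiantsHypothesis.ValiantsHypothesis.Theorems.NcLiteratureBridge
import Summits.ValiantsHypothesis.ValiantsHypothesis.Theorems.NcSemanticsBridge
import Summits.ValiantsHypothesis.ValiantsHypothesis.Theorems.SOSRoad
import HarnessLib

/-!
# NcSOSRoad — the sum-of-squares road to `A_nc` with HWY10 Theorem 1.7 as a NAMED FACT
(decomposition workshop `decomp-valiant`, lens 6 «restricted-models lifting axis», gen 5; supports
`DecompCycle1.PerNotSmVP`, stmt-ValiantsHypothesis-23661; critic K5a′ 2026-08-29T22:51:54Z /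
23:07:41Z: "HWY Thm 1.7 inline as `hHWY` is the one typing job left — ONE fact + the one-line edge to
`A_nc` converts `A_nc`'s road into a THEOREM-INPUT child with a numeric statement")

Gen 4's `Theorems/SOSRoad.lean` typed the road with HWY10 Thm 1.7 as an INLINE hypothesis and inside
the cone of the route file. This gen the theorem is a Literature named fact
`Literature.Computability.AlgebraicComplexity.HWY10_thm_1_7` (file `HWY10SumOfSquares.lean`, over the
Literature noncommutative semantics `NoncommutativeCircuits.lean`), and this file proves, on the
route-importable semantics `NcSemantics` (bridge `NcLiteratureBridge.ncEval_eq`):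

* `perNotNcVP_of_permNcExpHard : HWY10.PermNcExpHard ℂ → A_nc` (kernel: `2^{Ω(n)}` beats every
  polynomial eventually);
* `perNotNcVP_of_hwy : HWY10_thm_1_7 ℂ → HWY10.SOSBilinearSuperlinear ℂ → A_nc` — THE ROAD: numeric
  conjecture (`B_ℂ(SOS_k) ≥ Ω(k^{1+ε})`, OPEN) + theorem in print ⟹ `A_nc`;
* `sosBilinearSuperlinear_iff`, `permNcExpHard_iff`, `hwy_iff` — gen 4's INLINE hypothesis
  `hHWY : SOSRoad.SOSBilinearSuperlinear → SOSRoad.PermNcExpHard` IS the Literature fact `HWY10_thm_1_7 ℂ`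
  (the two typings of HWY's objects agree: definitionally for `B_F`, `SOS_k`; through the two
  semantics bridges for nc hardness), so `SOSRoad.perNotNcVP_of_sos` and `perNotNcVP_of_hwy` are one road.
(This file imports `Theorems/SOSRoad.lean`, hence the route file transitively: it is DOSSIER-side, not
route-importable — by design, a road is never a binder.)

Ledger reading (for the route dossier; the critic decides): `HWY10.SOSBilinearSuperlinear ℂ` is a
SUFFICIENT CHILD of the aside `A_nc` (stmt-ValiantsHypothesis-23446) modulo the fact `HWY10_thm_1_7 ℂ`;
both now have by-name signatures importable by `Theses/DecompCycle1.lean`.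
HONEST FRAMING: `SOSBilinearSuperlinear` is OPEN (`k ≤ B ≤ S ≤ O(k²/log k)`; `Ω(k^{6/5})` over `ℤ`
only, HWY10 Thm 1.10); the road is STRONGER in rate than `A_nc` and NOT implied by the summit (a road,
not a piece); nothing here is evidence for `VP ≠ VNP`.

## References

* [HrubesWigdersonYehudayoff2010] P. Hrubeš, A. Wigderson, A. Yehudayoff, *Non-commutative circuits and
  the sum-of-squares problem*, STOC 2010, §1.2–1.3, Thm 1.7, Thm 1.10.
* [Burgisser2000] P. Bürgisser, *Completeness and Reduction in Algebraic Complexity Theory*, Def. 2.1.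
-/

noncomputable section

namespace Summit.ValiantsHypothesis.ValiantsHypothesis.Theorems.NcSOSRoad

open Literature.Computability.AlgebraicComplexity
open Summit.ValiantsHypothesis.ValiantsHypothesis.Theorems

/-- **KERNEL EDGE**: exponential noncommutative hardness of the ordered permanent (the conclusion of
HWY10 Thm 1.7) implies the dial piece `A_nc = NcSemantics.PerNotNcVP` (superpolynomial hardness, i.o.).
[cite: HrubesWigdersonYehudayoff2010, Thm 1.7] -/
theorem perNotNcVP_of_permNcExpHard (h : HWY10.PermNcExpHard ℂ) : NcSemantics.PerNotNcVP := by
  rw [NcLiteratureBridge.perNotNcVP_iff]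
  obtain ⟨d, n₀, hd⟩ := h
  intro c
  obtain ⟨n, hn₀, hn⟩ := SOSRoad.exists_poly_lt_two_pow c d n₀
  exact ⟨n, fun hs => absurd (hd n hn₀ _ hs) (not_le.mpr hn)⟩

/-- **THE ROAD with the theorem in print NAMED**: HWY10 Thm 1.7 (Literature fact) turns the numeric
conjecture `B_ℂ(SOS_k) ≥ Ω(k^{1+ε})` into `A_nc`. [cite: HrubesWigdersonYehudayoff2010, Thm 1.7] -/
theorem perNotNcVP_of_hwy (h17 : HWY10_thm_1_7 ℂ) (hSOS : HWY10.SOSBilinearSuperlinear ℂ) :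
    NcSemantics.PerNotNcVP :=
  perNotNcVP_of_permNcExpHard (h17 hSOS)

/-- The road one level up: with the fact, the numeric conjecture and the residual `B_nc` give the
summit (`A_nc ∧ B_nc ⟹ S`). [cite: HrubesWigdersonYehudayoff2010, Thm 1.7] -/
theorem vh_of_hwy_ncLift (h17 : HWY10_thm_1_7 ℂ) (hSOS : HWY10.SOSBilinearSuperlinear ℂ)
    (hB : NcSemantics.NcLift) : _root_.ValiantsHypothesis :=
  NcSemantics.closes (perNotNcVP_of_hwy h17 hSOS) hB

/-! ## The gen-4 inline hypothesis is the Literature fact -/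

/-- The two typings of `B_F(SOS_k) ≥ Ω(k^{1+ε})` agree (definitionally). [cite: HrubesWigdersonYehudayoff2010, §1.3] -/
theorem sosBilinearSuperlinear_iff :
    SOSRoad.SOSBilinearSuperlinear ↔ HWY10.SOSBilinearSuperlinear ℂ :=
  Iff.rfl

/-- The two typings of "ordered `per` needs nc circuits of size `2^{Ω(n)}`" agree (through the
`CommutativityDial = NcSemantics = Literature` semantics bridges). [cite: HrubesWigdersonYehudayoff2010, Thm 1.7] -/
theorem permNcExpHard_iff : SOSRoad.PermNcExpHard ↔ HWY10.PermNcExpHard ℂ := by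
  constructor
  · rintro ⟨d, n₀, hd⟩
    refine ⟨d, n₀, fun n hn s hs => ?_⟩
    obtain ⟨P, hP, hev, hsz⟩ := (NcLiteratureBridge.hasNcCircuitSizeLE_iff _ _).mp hs
    have h := hd n hn P hP (by rw [NcSemanticsBridge.ncEval_eq, NcSemanticsBridge.ncPerPoly_eq, hev,
      NcLiteratureBridge.ncPerPoly_eq])
    exact h.trans (Nat.pow_le_pow_left (by omega) d)
  · rintro ⟨d, n₀, hd⟩
    refine ⟨d, n₀, fun n hn P hP hev => hd n hn P.size ?_⟩
    rw [NcLiteratureBridge.hasNcCircuitSizeLE_iff]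
    refine ⟨P, hP, ?_, le_rfl⟩
    rw [← NcSemanticsBridge.ncEval_eq, hev, NcSemanticsBridge.ncPerPoly_eq, NcLiteratureBridge.ncPerPoly_eq]

/-- **K5a′ in one line**: gen 4's inline hypothesis `hHWY` of `SOSRoad.perNotNcVP_of_sos` is exactly the
Literature named fact `HWY10_thm_1_7 ℂ`. [cite: HrubesWigdersonYehudayoff2010, Thm 1.7] -/
theorem hwy_iff : (SOSRoad.SOSBilinearSuperlinear → SOSRoad.PermNcExpHard) ↔ HWY10_thm_1_7 ℂ := by
  unfold HWY10_thm_1_7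
  rw [sosBilinearSuperlinear_iff, permNcExpHard_iff]

/-- Hence gen 4's road and this file's road coincide: with the fact, `SOSRoad.perNotNcVP_of_sos` fires.
[cite: HrubesWigdersonYehudayoff2010, Thm 1.7] -/
theorem perNotNcVP_of_sos' (h17 : HWY10_thm_1_7 ℂ) (hSOS : SOSRoad.SOSBilinearSuperlinear) :
    CommutativityDial.PerNotNcVP :=
  SOSRoad.perNotNcVP_of_sos (hwy_iff.mpr h17) hSOS

end Summit.ValiantsHypothesis.ValiantsHypothesis.Theorems.NcSOSRoad

end
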